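import Literature.MathematicalPhysics.QuantumFieldTheory.Balaban1983to89.Node00.ROperationOfRecord
import Literature.MathematicalPhysics.QuantumFieldTheory.Balaban1983to89.B16Stage3Regions

/-!
# NODE 00 — DEFINER ₇ support (typing hand `pub-ymgap-dag-n12-b`, on DEFINER ₇'s word [NODE00-DEF-R-G0-WORDS-1]):
# [IV] §1 (1.1)–(1.2) pp. 177–178 AS DATA — the represented large-field tower after `k` steps (one TERM `Z` of the expansion
# (0.2)/(2.18) [III] with its component and restriction regions; the finite FAMILY of terms; its `B15RopTotal.RepData`), the two
# shape Props «(1.1) factorization over the components of Z» and «(1.2) the last N one-step operations», and the PIN SHAPE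
# `repOfTower` turning a tower of record into DEFINER ₇'s residual datum `RepOfRecord`

[IV] = [Balaban1989LargeFieldI] (CMP 122:175), [III] = [Balaban1988Convergent] (CMP 119:243).  Proposed on the bus as
[DAGN12B-G0-TOWERSHAPES-DECLS], ACCEPTED WITH THREE CUTS by DEFINER ₇ [NODE00-DEF-R-G0-TOWERSHAPES-ACCEPT] ((a) regions in two
layers — geometry exactly as `B16Stage3Regions` has it (`Set (Pt d)`, its `farZ ∕ Zk ∕ Lam` reused by name; first layer free of
proof obligations), integration data exactly as `B15RopTotal.RepData`; (b) `Factorizes11` with an abstract `DependsOn`;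
`LastNSteps12` only as a Prop with the density chain inside the `∃`; (c) names); the definitions of record are DEFINER ₇'s (this
seat types under their module's imports; no def of record originates here).  CARRIER ONLY: which `TowerRep` the record's tower IS
(the recursion terms_{k+1} = re-expansion ∘ 𝐓_k ∘ terms_k, then 𝐑′) is ₇b's DEFINITION still owed; nothing of Bałaban asserted.

THE PRINT (verbatim).  (0.2) p. 176: *«ρ(V) = Σ_Z ρ(Z, V)»*.  p. 177: *«Let us denote the union of the above class of components by Z.
For simplicity we denote intersections of the regions Z_j with Z by Z_j also, hence Z_k is identified with Z. … Thus we write the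
factorization property (2.19) [III], 𝐓_k(Z_k) = 𝐓_k(Z_k ∩ Zᶜ)𝐓_k(Z) = 𝐓_k(Z_k ∩ Zᶜ) ∏_{i=1}^n 𝐓_k(X_i), (1.1) where Z = ⋃_{i=1}^n X_i
is the decomposition into disjoint components. In this section we do not make any changes in the operation 𝐓_k(Z_k ∩ Zᶜ), therefore
we will usually omit it in the formulas.»*  p. 178: *«We consider 𝐓_k(Z)exp A_k, and we use the above described simplified notation.
Using the conditions (i), (ii), and the factorization property (2.22) [III], we write [(1.2): the product over j = h, …, k − 1,
h = k − N, of the one-step operations 𝐓^{(j)}(Z_j) with the first and the last characteristic functions written explicitly] …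
These operations are given by the formula (2.21) [III], in which the functions ζ, χ have the simplest form, namely by the
condition (ii) no large field characteristic functions are included in them.»*  (0.3) p. 176: *«(𝐑ρ)(V) = Σ_Z ρ(Z″, V) ∫dV⌈_{Z′}
ρ(Z, V) [∫dV⌈_{Z′} ρ(Z″, V)]⁻¹»*.

CENSUS (nothing below restates them; referred to BY NAME): the seven groups (1.3)–(1.9) = r12's `B15.PrelimIntegrations.SF13 ∕ SF15 ∕
gfDensity16 ∕ SF17 ∕ SF19` (letters) and r11's `B15Eq13Concrete` (bodies); the regions (1.10)–(1.12) = `B16Stage3Regions`; the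
stopping conditions (i), (ii) p. 177 = `B16StoppingRule.CondI ∕ CondII ∕ StopAt`; (0.3)/(0.4) = b01's `B15.BasicStep` and this
seat's `B15RopTotal.ropTotal` (DEFINER ₇'s `ROp03OfRecord`).  NOT typed anywhere before this file: (1.1)/(1.2) as a DATA STRUCTURE
carrying a density together with its expansion (r12's header: «the integrals (1.2), … are NOT typed here (construction formulas
over the machinery of [III] §2–§3)»).

WHAT THIS FILE DEFINES (definitions + `rfl`-level bookkeeping; no estimate, no `instance`, no `notation`, no `sorry`).
§1 `TowerTerm` — ONE term `Z` in two layers: geometry (`Z`, components `X_i`, `Z′`, `Z″` as point sets of `B16Stage3Regions`'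
   lattice `Pt d`) and integration data (bond variables of the components and of `Z′`, the piece `ρ(Z, ·)`, as in `RepData`).
§2 `TowerRep` — the finite family (index type + `Fintype` FIELD, the map `Z ↦ Z″` on indices, the terms); `TowerRep.total`
   ((0.2)); `TowerRep.toRepData` (the `B15RopTotal.RepData` it carries) with `toRepData_total`.
§3 shape Props: `DependsOn`, `Factorizes11` ((1.1): the piece is a product over the components of functions of the variables
   on them, times the untouched factor), `LastNSteps12` ((1.2): the piece is reached from a level-`h` density by the last
   `N = k − h` one-step operations, each applied after multiplication by that level's characteristic-function group — the
   operations `𝐓^{(j)}` and the groups are LETTERS).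
§4 `repOfTower` — THE PIN SHAPE for DEFINER ₇'s residual `RepOfRecord`: a tower of record `T p k : TowerRep …` yields
   `rep p k ρ := if ρ = (T p k).total then (T p k).toRepData else trivialRep ρ` — Bałaban's branch of `ropTotal` exactly on the
   tower's own total density, the labelled identity convention elsewhere; `repOfTower_apply_total`, `repOfTower_of_ne`, `admissible_repOfTower_iff`, `ROp03OfRecord_repOfTower_total`,
   `ROp03OfRecord_repOfTower_total_of_provisos` (under the provisos, `R` of record on the tower's own density IS print's (0.3)).
HONEST FRAMING: definitions of carriers and shape predicates; nothing of Bałaban's is asserted; counts unmoved; NOT continuum ∕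
OS ∕ mass-gap ∕ Clay.
-/

noncomputable section

open scoped BigOperators

namespace Literature.MathematicalPhysics.QuantumFieldTheory.Balaban1983to89.Node00

open T4Continuum B15RopTotal

/-! ## §1  One term of the expansion -/

section Shapes

variable (P : Params) (k : ℕ) (G : Type*) [GaugeGroup G]

/-- **One term `Z` of the represented density after `k` steps** ([IV] p. 177, (0.2)/(2.18) [III]), in TWO LAYERS: the geometry
(the region `Z` — «Z_k is identified with Z» —, its disjoint components `X_1, …, X_n` of (1.1), the split `Z′`/`Z″` of (0.3),
all point sets of `B16Stage3Regions`' lattice, whose `farZ ∕ Zk ∕ Zk0 ∕ Lam` name the printed regions (1.10)–(1.12)) and the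
integration data (the bond variables on the components, the `Z′` bond variables, the piece `ρ(Z, ·)` — as in
`B15RopTotal.RepData`). [cite: Balaban1989LargeFieldI, (1.1) p.177, (0.2)–(0.3) p.176] -/
structure TowerTerm where
  /-- GEOMETRY LAYER (`B16Stage3Regions`' lattice `Pt d = ℤᵈ`, `d = P.d`; no proof obligations): the region `Z` -/
  Zset : Set (B14DomainGeom.Pt P.d)
  /-- the components `X_i` of `Z` ((1.1)), as an index type -/
  Comp : Type
  /-- finitely many components -/
  [finComp : Fintype Comp]
  /-- the point set of the component `X_i` -/
  compSet : Comp → Set (B14DomainGeom.Pt P.d)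
  /-- `Z′` ((0.3): the part integrated over) as a point set -/
  Zp : Set (B14DomainGeom.Pt P.d)
  /-- `Z″ = Z ∖ Z′` as a point set -/
  Zpp : Set (B14DomainGeom.Pt P.d)
  /-- INTEGRATION LAYER (exactly as `B15RopTotal.RepData`): the bond variables on (a neighbourhood of) `X_i` — what `𝐓_k(X_i)`
  depends on -/
  compVars : Comp → Set (PBond P k)
  /-- the bond variables of `Z′` integrated out by (0.3) (`RepData.fib`) -/
  fibVars : Finset (PBond P k)
  /-- the piece `ρ(Z, ·)` (`RepData.piece`) -/
  piece : Density P k G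

/-! ## §2  The finite family of terms and its `RepData` -/

/-- **The represented tower after `k` steps**: finitely many terms (index type with a `Fintype` FIELD — no instance), the map
`Z ↦ Z″` ON INDICES (the term of the expansion that (0.3) puts in the denominator), and the terms. [cite: Balaban1989LargeFieldI, (0.2)–(0.3) p.176, (1.1) p.177] -/
structure TowerRep where
  /-- the terms `Z` of the expansion, as an index type -/
  ι : Type
  /-- finitely many terms -/
  [fin : Fintype ι]
  /-- `Z ↦ Z″` on indices -/
  pp : ι → ι
  /-- the terms -/
  term : ι → TowerTerm P k G

variable {P k G}

namespace TowerRep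

/-- `Σ_Z ρ(Z, ·)` — the density the tower represents ((0.2)); the sum runs over the datum's own `Fintype` field.
[cite: Balaban1989LargeFieldI, (0.2) p.176] -/
def total (T : TowerRep P k G) : Density P k G :=
  fun V => @Finset.sum T.ι ℝ _ (@Finset.univ T.ι T.fin) fun Z => (T.term Z).piece V

/-- The `B15RopTotal.RepData` the tower carries: regions = the term indices, `Z ↦ Z″`, the `Z′` bond variables, the pieces.
[cite: Balaban1989LargeFieldI, (0.2)–(0.3) p.176] -/
def toRepData (T : TowerRep P k G) : RepData P k G :=
  @RepData.mk P k G _ T.ι T.fin T.pp (fun Z => (T.term Z).fibVars) (fun Z => (T.term Z).piece)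

/-- The carried `RepData` represents the same density. [cite: Balaban1989LargeFieldI, (0.2) p.176 (bookkeeping)] -/
theorem toRepData_total (T : TowerRep P k G) : T.toRepData.total = T.total := rfl

end TowerRep

/-! ## §3  The shape Props (1.1), (1.2) -/

/-- «depends only on the variables in `S`». [cite: Balaban1989LargeFieldI, p.177 («localized in»; bookkeeping)] -/
def DependsOn {j : ℕ} (S : Set (PBond P j)) (f : Density P j G) : Prop :=
  ∀ V W : GaugeField P j G, (∀ b ∈ S, V b = W b) → f V = f W

/-- **(1.1) as a shape**: *«𝐓_k(Z_k) = 𝐓_k(Z_k ∩ Zᶜ) ∏_{i=1}^n 𝐓_k(X_i)»* — the piece of the term is the untouched factor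
(«we do not make any changes in the operation 𝐓_k(Z_k ∩ Zᶜ)») times a product over the components of factors each depending
only on the variables of its component. [cite: Balaban1989LargeFieldI, (1.1) p.177] -/
def Factorizes11 (t : TowerTerm P k G) : Prop :=
  ∃ (f₀ : Density P k G) (f : t.Comp → Density P k G),
    (∀ i, DependsOn (t.compVars i) (f i)) ∧
      ∀ V, t.piece V = f₀ V * @Finset.prod t.Comp ℝ _ (@Finset.univ t.Comp t.finComp) fun i => f i V

/-- **(1.2) as a shape**: the piece is reached from a level-`h` density, `h = k − N`, by the last `N` one-step operations
`𝐓^{(j)}(Z_j)`, `j = h, …, k − 1`, each applied to the previous density multiplied by that level's characteristic-function group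
(the seven groups (1.3)–(1.9) in «the simplest form», condition (ii) p. 177 — r12's `SF…` letters ∕ r11's `B15Eq13Concrete`
bodies, `B16StoppingRule.CondII`); the operations and the groups are LETTERS. [cite: Balaban1989LargeFieldI, (1.2) p.178] -/
def LastNSteps12 (t : TowerTerm P k G) (h : ℕ) (Tstep : (j : ℕ) → Density P j G → Density P (j + 1) G)
    (grp : (j : ℕ) → Density P j G) : Prop :=
  ∃ ρs : (j : ℕ) → Density P j G,
    ρs k = t.piece ∧ ∀ j, h ≤ j → j < k → ρs (j + 1) = Tstep j (fun V => ρs j V * grp j V)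


/-! ### v1.1 — the LOCALISED (1.1) shape (repair of `Factorizes11`, dag-ref-B READ-88 A2 pin)

`Factorizes11` above is VACUOUS as typed (every term satisfies it with `f₀ := t.piece`, `f i := 1`: the untouched factor carries no
locality constraint, so the whole piece hides in it — dag-ref-B's kernel-checked probe).  Print's (1.1) localises the untouched
factor `𝐓_k(Z_k ∩ Zᶜ)` on the variables OUTSIDE `Z`; the repaired shape below takes that variable set as a PARAMETER `outVars`
(supplied by the tower of record like `compVars`; a new structure field would not be append-only).  Consumers use `Factorizes11Loc`;
`LastNSteps12`'s consumers carry `h < k` (for `h ≥ k` the chain is empty). -/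

/-- **(1.1) as a shape, LOCALISED** (supersedes the vacuous `Factorizes11`): *«𝐓_k(Z_k) = 𝐓_k(Z_k ∩ Zᶜ) ∏_{i=1}^n 𝐓_k(X_i)»* — the
piece is an untouched factor depending only on the variables `outVars` of `Z_k ∩ Zᶜ` (and its neighbourhood) times a product over
the components of factors each depending only on the variables of its component. [cite: Balaban1989LargeFieldI, (1.1) p.177] -/
def Factorizes11Loc (t : TowerTerm P k G) (outVars : Set (PBond P k)) : Prop :=
  ∃ (f₀ : Density P k G) (f : t.Comp → Density P k G),
    DependsOn outVars f₀ ∧ (∀ i, DependsOn (t.compVars i) (f i)) ∧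
      ∀ V, t.piece V = f₀ V * @Finset.prod t.Comp ℝ _ (@Finset.univ t.Comp t.finComp) fun i => f i V

omit [GaugeGroup G] in
/-- The localised shape implies the (localisation-free, vacuous) shadow `Factorizes11`. [cite: Balaban1989LargeFieldI, (1.1) p.177 (bookkeeping)] -/
theorem factorizes11_of_loc {t : TowerTerm P k G} {outVars : Set (PBond P k)} (h : Factorizes11Loc t outVars) :
    Factorizes11 t := by
  obtain ⟨f₀, f, -, hf, hprod⟩ := h
  exact ⟨f₀, f, hf, hprod⟩

end Shapes

/-! ## §4  The pin shape for DEFINER ₇'s residual `RepOfRecord` -/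

section Pin

variable (F : T4Family) (N : ℕ) [NeZero N]

/-- **A represented tower of record**: for each run `p` and step `k`, the tower after `k + 1` steps (DEFINER ₇'s carrier
`Density (F.P p.K) (k + 1) (SU N)`). [cite: Balaban1989LargeFieldI, (0.2) p.176, (1.1) p.177] -/
abbrev TowerOfRecord : Type 1 :=
  (p : B12.RunParams) → (k : ℕ) → TowerRep (F.P p.K) (k + 1) (SU N)

open Classical in
/-- **THE PIN SHAPE**: a tower of record yields the representation-extraction datum — Bałaban's (0.2)-representation EXACTLY on
the tower's own total density, the labelled one-region convention (`trivialRep`, identity branch of `ropTotal`) on every other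
density. [cite: Balaban1989LargeFieldI, (0.2)–(0.3) p.176] -/
def repOfTower (T : TowerOfRecord F N) : RepOfRecord F N :=
  fun p k ρ => if ρ = (T p k).total then (T p k).toRepData else trivialRep ρ

open Classical in
/-- On the tower's total density the datum is the tower's `RepData`. [cite: Balaban1989LargeFieldI, (0.2) p.176 (bookkeeping)] -/
theorem repOfTower_apply_total (T : TowerOfRecord F N) (p : B12.RunParams) (k : ℕ) :
    repOfTower F N T p k (T p k).total = (T p k).toRepData := by
  simp [repOfTower]

open Classical in
/-- Off the tower's total density the datum is the one-region convention. [cite: Balaban1989LargeFieldI, (0.2) p.176 (typing convention)] -/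
theorem repOfTower_of_ne (T : TowerOfRecord F N) {p : B12.RunParams} {k : ℕ} {ρ : Density (F.P p.K) (k + 1) (SU N)}
    (h : ρ ≠ (T p k).total) : repOfTower F N T p k ρ = trivialRep ρ := by
  simp [repOfTower, h]

open Classical in
/-- Admissibility of the tower's own total density for `ropTotal` is exactly the provisos of p. 176 on the tower's `RepData`
(the representation clause holds by `toRepData_total`). [cite: Balaban1989LargeFieldI, (0.3) p.176 («the densities are positive, …
the denominators are positive»)] -/
theorem admissible_repOfTower_iff (T : TowerOfRecord F N) (p : B12.RunParams) (k : ℕ) :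
    Admissible (repOfTower F N T p k) (T p k).total ↔ (T p k).toRepData.Provisos := by
  unfold Admissible
  rw [repOfTower_apply_total]
  exact and_iff_right (TowerRep.toRepData_total _)

open Classical in
/-- Consequently `R` of record at the tower's own density is `ropTotal` of the tower's `RepData` there (print's (0.3) when the
provisos hold, by `ROp03OfRecord_of_admissible`). [cite: Balaban1989LargeFieldI, (0.3) p.176 (bookkeeping)] -/
theorem ROp03OfRecord_repOfTower_total (T : TowerOfRecord F N) (p : B12.RunParams) (k : ℕ) :
    ROp03OfRecord F N (repOfTower F N T) p k (T p k).total = ropTotal (repOfTower F N T p k) (T p k).total := rfl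

open Classical in
/-- **On the record's own tower, under the provisos of p. 176, `R` of record IS print's (0.3)** of the tower's representation
(`ROp03OfRecord_of_admissible` ∘ `admissible_repOfTower_iff`) — the line ₇b and the N12 knit cite. [cite: Balaban1989LargeFieldI, (0.3) p.176] -/
theorem ROp03OfRecord_repOfTower_total_of_provisos (T : TowerOfRecord F N) (p : B12.RunParams) (k : ℕ)
    (h : (T p k).toRepData.Provisos) :
    ROp03OfRecord F N (repOfTower F N T) p k (T p k).total = (T p k).toRepData.rop := by
  rw [ROp03OfRecord_of_admissible F N ((admissible_repOfTower_iff F N T p k).2 h), repOfTower_apply_total]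

end Pin

end Literature.MathematicalPhysics.QuantumFieldTheory.Balaban1983to89.Node00

end
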